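import Summits.KontsevichZagierPeriods.KontsevichZagierPeriods.Theorems.RootDecompRelativeModAbsoluteCircleSplitP07

/-! # `RootDecompRelativeModAbsoluteCircleSplitP08` — part 8/11 of the mechanical ≤400-line split of `csk_min.lean` (sha256 066c56c743abe73e…)
Source: decomp-kz lens-3 g14 CircleSplitK.lean @3d3b9378 (= CircleSplit @d1112051 §0–§25 + §26 kernel split + §27 odd→log; critic CLEARED g6-21 l.1371, g7-2 l.1388) minus the 65 declarations already landed in …CircleLogP1–P11 / …CylLogSplitP46–P49 and minus the 20 superseded g13-glue/tame-class lemmas not on the §26–§27 chain; imports …CylLogSplitP48 + …CircleLogP11; --supports stmt-KontsevichZagierPeriods-30572.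
Split by census-1 g10 `gen/splitlean.py`: scopes re-opened with their `open`/`variable`/`set_option` context; mathematics and declaration order unchanged. -/

noncomputable section
open Set MeasureTheory Filter Topology
open scoped BigOperators
open Literature.NumberTheory.Transcendental Literature.ModelTheory.ExponentialFields
namespace Summit.KontsevichZagierPeriods.RootDecompRelativeModAbsolute.Rung30571.RegularisedLogLayer.CylLog.Leaf
namespace G13
variable {b : ℕ}

/-- **`CircleLogStructureAt 1` — PROVED** (the loop + §23 `circleLogStructure_of_exact`). -/
theorem circleLogStructureAt_one : CircleLogStructureAt 1 := by
  intro k l U h W p u g hU hh hW hW0 hp hu hg hid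
  exact circleLogStructure_of_exact (exactLevel_all k l U h W p u g hU hh hW hW0 hp hu hg hid)

open scoped ContDiff in
/-- **`CircleLogStructureMovingCirc` — PROVED** (a special case of `circleLogStructureAt_one`; the residual of node v11 is DISCHARGED). -/
theorem circleLogStructureMovingCirc_holds : CircleLogStructureMovingCirc := by
  intro k l U h W p u g hU _ _ hh hW hW0 hp hu hg _ _ _ _ _ _ _ hid
  exact circleLogStructureAt_one k l U h W p u g hU hh hW hW0 hp hu hg hid

/-! ### §25 THE g14 NODE (PROVED glue): the transcendence residual is DISCHARGED

`CircleLogStructureMovingCirc` is a THEOREM (§24 `circleLogStructureMovingCirc_holds`), so node v11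
`CircleLogStructureMovingCirc → LogCellwiseFoldAt 1 → AngleCellwiseFoldAt 1 → CellCloseCSWild → CylKernelZeroCirclePos` (§15) loses its
first hypothesis: the residual `CylKernelZeroCirclePos` of item 30572 now follows from the TREE's log fold (`LogCellwiseFoldAt 1`, =
`stub_cellwiseFold stub_coneDecomposition 1` once `…StubCellwiseFold` is built on the farm), ONE family angle-addition statement
(`AngleCellwiseFoldAt 1`) and the wild residual (`CellCloseCSWild`). -/

/-! ## §26 (g14, 2026-08-31) THE KERNEL SPLIT — the wild residual re-routed.
The tree CLOSES the logarithmic kind outright: `cylKernelZeroLog_of_trees (LogStructure) (BoundaryRigidity) : CylKernelZeroLog`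
(`…CylLogSplitP45`), both inputs tree theorems (`LogStructure` = `stub_structure …`, P01 doc; `boundaryRigidity_of_stubs`,
`Theorems/LiouvilleUnfoldingLogPrimitiveNL.lean` l.44).  Inside `CellCloseCS` the log relations and the angle relations are
SEPARATELY exact, so on a cell whose circle indices have EVEN order the cylinder splits HONESTLY by kernel:
`V = V^L + V^A`, `V^L = [E×(0,1); a₀^L + Σ_{eᵢ=1} cᵢθ^{Mᵢ}/(1+θκᵢ)]` with `a₀^L := −Σ_{eᵢ=1} cPolyᵢ` (integrable BECAUSE
`Σᵢ cLogᵢ·log(1+κᵢ) ≡ 0` on the cell), closed by `CylKernelZeroLog`; and `V^A = [E×(0,1); a₀^A + Σ_{eᵢ=2} cᵢθ^{Mᵢ}/(1+θ²κᵢ)]`,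
`a₀^A := a₀ − a₀^L`, a PURE ARCTANGENT-KERNEL cylinder with exact angle relations — the new, self-contained residual
`EvenCircleCellClose` (no log data, no tame/wild dichotomy, no boundary rigidity).  Odd circle orders are log kind after
`θ' = θ²` (`θ^{2j+1}dθ/(1+θ²κ) = ½ θ'^j dθ'/(1+θ'κ)`), g15 item.  PROVED here: `cellCloseCSEven_of_log_and_evenCircle`. -/

open scoped ContDiff in
/-- **`CellCloseCSEven`** — `CellCloseCS` on cells whose circle indices (`eᵢ = 2`) have EVEN order `Mᵢ`
(token-identical to `CellCloseCS` except: the hypothesis `∃ i, e i = 2` is DROPPED — a converted cell may be purely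
logarithmic — and `∀ i, e i = 2 → M i % 2 = 0` is added in its place). -/
def CellCloseCSEven : Prop :=
  ∀ (E : Set (Fin 1 → ℝ)) (V : KZ.IntegralRep (1 + 1)) (a₀ : (Fin 1 → ℝ) → ℝ) (q : ℕ)
    (c κ : Fin q → (Fin 1 → ℝ) → ℝ) (M e : Fin q → ℕ) (σ : Fin q → Fin 3)
    (R : ℕ) (f : Fin R → Fin q → ℤ) (qq : Fin R → (Fin 1 → ℝ) → ℝ)
    (S : ℕ) (f' : Fin S → Fin q → ℤ) (m : Fin S → ℚ) (qq' : Fin S → (Fin 1 → ℝ) → ℝ),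
    IsOpen E → IsSemialgebraic ℚ E →
    IsSemialgebraicFunOn ℚ E a₀ → ContDiffOn ℝ ∞ a₀ E → IntegrableOn a₀ E →
    (∀ i, IsSemialgebraicFunOn ℚ E (c i)) → (∀ i, ContDiffOn ℝ ∞ (c i) E) →
    (∀ i, IsSemialgebraicFunOn ℚ E (κ i)) → (∀ i, ContDiffOn ℝ ∞ (κ i) E) →
    (∀ i, e i = 1 ∨ e i = 2) → (∀ i, e i = 2 → M i % 2 = 0) →
    (∀ i, ∀ x ∈ E, -1 < κ i x) →
    (∀ i, σ i = 0 → ∀ x ∈ E, 0 < κ i x) → (∀ i, σ i = 1 → ∀ x ∈ E, κ i x < 0) →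
    (∀ i, σ i = 2 → ∀ x ∈ E, κ i x = 0) → (∀ i, e i = 2 → ∀ x ∈ E, 0 < κ i x) →
    (∀ i, IntegrableOn (fun z : Fin (1 + 1) → ℝ =>
      c i (Fin.init z) * (z (Fin.last 1) ^ M i / (1 + z (Fin.last 1) ^ e i * κ i (Fin.init z))))
      {z : Fin (1 + 1) → ℝ | (Fin.init z : Fin 1 → ℝ) ∈ E ∧ z (Fin.last 1) ∈ Set.Ioo 0 1}) →
    (∀ i, IntegrableOn (fun x => c i x * ∫ θ in Set.Ioo (0 : ℝ) 1, θ ^ M i / (1 + θ ^ e i * κ i x)) E) →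
    V.domain = {z : Fin (1 + 1) → ℝ | (Fin.init z : Fin 1 → ℝ) ∈ E ∧ z (Fin.last 1) ∈ Set.Ioo 0 1} →
    Set.EqOn V.integrand (fun z => a₀ (Fin.init z) +
      ∑ i, c i (Fin.init z) * (z (Fin.last 1) ^ M i / (1 + z (Fin.last 1) ^ e i * κ i (Fin.init z))))
      V.domain →
    (∀ x ∈ E, a₀ x + ∑ i, cPoly e (sgnB σ) c κ M i x = 0) →
    (∀ r, IsSemialgebraicFunOn ℚ E (qq r)) →
    (∀ r, ∀ x ∈ E, ∏ i, (1 + κ i x) ^ (f r i) = 1) →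
    (∀ i, ∀ x ∈ E, cLog e (sgnB σ) c κ M i x = ∑ r, qq r x * (f r i : ℝ)) →
    (∀ s, IsSemialgebraicFunOn ℚ E (qq' s)) →
    (∀ s, ∀ x ∈ E, ∑ i, (f' s i : ℝ) * Real.arctan (atanArg e κ i x) = (m s : ℝ) * Real.pi) →
    (∀ x ∈ E, ∑ s, qq' s x * (m s : ℝ) = 0) →
    (∀ i, ∀ x ∈ E, cAtan e c κ M i x = ∑ s, qq' s x * (f' s i : ℝ)) →
    KZ.of V ∈ KZ.relations

open scoped ContDiff in
/-- **`EvenCircleCellClose` — THE NEW RESIDUAL (pure arctangent kernels).**  On an open `ℚ`-sa cell `E ⊆ ℝ¹`: a cylinder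
`[E×(0,1); a₀ + Σᵢ cᵢ θ^{Mᵢ}/(1+θ²κᵢ)]` with every `Mᵢ` EVEN, `κᵢ > 0` smooth `ℚ`-sa, `cᵢ` smooth `ℚ`-sa, honest pieces,
the polynomial identity `a₀ + Σᵢ cᵢ·sqPoly 0 (Mᵢ/2) κᵢ ≡ 0`, and EXACT angle relations `Σᵢ f′_s i·arctan √κᵢ ≡ m_s π`
(`m_s ∈ ℚ`) with budget `Σ_s qq′_s m_s ≡ 0` carrying the arctangent coefficients
`cᵢ·sqTrans 0 (Mᵢ/2) κᵢ/√κᵢ = Σ_s qq′_s f′_s i`, is a relation.  No logarithmic data at all.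
[UNDECIDED · ATTACKABLE-WITH-PLAN (HOME g14 `BLUEPRINT-wild.md`: base-curve substitution `θ = uᵢ(ξ)/uᵢ(x)` on half-cells —
the transcendental part `Σᵢ cAtanᵢ(x)·arctan uᵢ(ξ)` of the `ξ`-primitive vanishes IDENTICALLY, so ONE Newton–Leibniz move
folds all moving parts; constant bands by `AngleFold.constAngleFold`; `uᵢ → ∞` ends by the full-ray trick); WEAKER than
`CellCloseCS` (its `e ≡ 2`, `M` even, `R = 0` instance up to the coefficient dictionary)] -/
def EvenCircleCellClose : Prop :=
  ∀ (E : Set (Fin 1 → ℝ)) (V : KZ.IntegralRep (1 + 1)) (a₀ : (Fin 1 → ℝ) → ℝ) (q : ℕ)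
    (c κ : Fin q → (Fin 1 → ℝ) → ℝ) (M : Fin q → ℕ)
    (S : ℕ) (f' : Fin S → Fin q → ℤ) (m : Fin S → ℚ) (qq' : Fin S → (Fin 1 → ℝ) → ℝ),
    IsOpen E → IsSemialgebraic ℚ E →
    IsSemialgebraicFunOn ℚ E a₀ → IntegrableOn a₀ E →
    (∀ i, IsSemialgebraicFunOn ℚ E (c i)) → (∀ i, ContDiffOn ℝ ∞ (c i) E) →
    (∀ i, IsSemialgebraicFunOn ℚ E (κ i)) → (∀ i, ContDiffOn ℝ ∞ (κ i) E) →
    (∀ i, M i % 2 = 0) → (∀ i, ∀ x ∈ E, 0 < κ i x) →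
    (∀ i, IntegrableOn (fun z : Fin (1 + 1) → ℝ =>
      c i (Fin.init z) * (z (Fin.last 1) ^ M i / (1 + z (Fin.last 1) ^ 2 * κ i (Fin.init z))))
      {z : Fin (1 + 1) → ℝ | (Fin.init z : Fin 1 → ℝ) ∈ E ∧ z (Fin.last 1) ∈ Set.Ioo 0 1}) →
    (∀ i, IntegrableOn (fun x => c i x * ∫ θ in Set.Ioo (0 : ℝ) 1, θ ^ M i / (1 + θ ^ 2 * κ i x)) E) →
    V.domain = {z : Fin (1 + 1) → ℝ | (Fin.init z : Fin 1 → ℝ) ∈ E ∧ z (Fin.last 1) ∈ Set.Ioo 0 1} →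
    Set.EqOn V.integrand (fun z => a₀ (Fin.init z) +
      ∑ i, c i (Fin.init z) * (z (Fin.last 1) ^ M i / (1 + z (Fin.last 1) ^ 2 * κ i (Fin.init z))))
      V.domain →
    (∀ x ∈ E, a₀ x + ∑ i, c i x * sqPoly 0 (M i / 2) (κ i x) = 0) →
    (∀ s, IsSemialgebraicFunOn ℚ E (qq' s)) →
    (∀ s, ∀ x ∈ E, ∑ i, (f' s i : ℝ) * Real.arctan (Real.sqrt (κ i x)) = (m s : ℝ) * Real.pi) →
    (∀ x ∈ E, ∑ s, qq' s x * (m s : ℝ) = 0) →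
    (∀ i, ∀ x ∈ E, c i x * sqTrans 0 (M i / 2) (κ i x) / Real.sqrt (κ i x) = ∑ s, qq' s x * (f' s i : ℝ)) →
    KZ.of V ∈ KZ.relations

end G13
end Summit.KontsevichZagierPeriods.RootDecompRelativeModAbsolute.Rung30571.RegularisedLogLayer.CylLog.Leaf
end
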